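import Literature.Probability.Percolation.CLE6
import Literature.Probability.RandomPlanarGeometry.UnbasedLoops
import Mathlib.MeasureTheory.Integral.IntegrableOn
import Mathlib.Topology.MetricSpace.Closeds
import HarnessLib

/-!
# Rerooting loop collections: `1`-Lipschitz on loops, measurability, and the unrooted limit law

Topic `Literature/Probability/Percolation`, companion to `CLE6.lean` (proofs only, no new
definitions). `CLE6.lean` states the Camia–Newman full scaling limit twice: the rooted form
`exists_isCLEFamily_six_tendsto` (the original rendering of crit-perc.S05: convergence of the
percolation loop collections `triLoopCollection D δ` to the *reroot-saturation*
`LoopSpace.rerootSaturation L` of a sample `L` of a rooted CLE-type family `μ`; **deprecated**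
as mis-stated since the verdict clean-up of 2026-08-16) and the unrooted form printed in the
sources, `exists_isCNLFamily_tendsto` (convergence to a law `ν D` of reroot-saturated
collections; the live statement of crit-perc.S05). This file supplies the elementary analysis
linking the two:

* `dist_reroot_reroot_le` — rerooting two *loops* at the same parameter does not increase the sup
  distance of the parametrisations (the rerooted curves visit the same parameters,
  `Curve.reroot_apply`); hence, on collections all of whose members are loops,
  `LoopSpace.rerootSaturation` is `1`-Lipschitz for the Hausdorff extended distance
  (`edist_rerootSaturation_le`, `lipschitzOnWith_rerootSaturation`), in particular continuous
  there; the set of such collections is closed (`isClosed_setOf_forall_isLoop`), so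
  `rerootSaturation` is a.e.-measurable for every law carried by loop collections
  (`aemeasurable_rerootSaturation`). (It is *not* continuous at collections containing non-loops,
  where `Curve.reroot` is the identity by convention.)
* `TendstoLaw.id_map` — if `Y δ → Z` in law under `P'` and `Z` is a.e.-measurable, then
  `Y δ → id` in law under the push-forward `P'.map Z` (change of variables).
* Consequences for crit-perc.S05: a rooted limit as in `exists_isCLEFamily_six_tendsto` yields the
  unrooted limit law `(μ D).map rerootSaturation` (`tendstoLaw_id_map_rerootSaturation`), and by
  uniqueness of limits in law (`TendstoLaw.map_eq`, Billingsley Thm 1.2) any unrooted limit law —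
  in particular the CNL law `ν D` of `exists_isCNLFamily_tendsto` — equals it
  (`law_eq_map_rerootSaturation`, `cnlFamily_eq_map_rerootSaturation`). So the rooted statement
  determines the Camia–Newman law; the converse direction (manufacturing a conformally
  *equivariant* rooting of the CNL process) is the part of the rooted statement not covered by
  the sources, see the audit section of `CLE6.lean`. The two closing theorems whose hypothesis
  *is* the deprecated rooted fact (`exists_cnlFamily_eq_map_rerootSaturation`,
  `exists_tendstoLaw_id_of_exists_isCLEFamily_six_tendsto`) are deprecated with it (2026-08-16)
  and kept verbatim as the machine-checked record that the corrected statement asks for less;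
  `linter.deprecated` is switched off for those two declarations only. Everything stated for a
  general law `P'` / family `μ` (`tendstoLaw_id_map_rerootSaturation`,
  `law_eq_map_rerootSaturation`, `cnlFamily_eq_map_rerootSaturation`) is unaffected.

References: F. Camia, C. M. Newman, Comm. Math. Phys. 268 (2006) 1–38, §2.2 (curves modulo
monotone reparametrisation, closed sets of curves with the induced Hausdorff metric)
[CamiaNewman2006]; M. Aizenman, A. Burchard, Duke Math. J. 99 (1999), §2.1; P. Billingsley,
*Convergence of probability measures*, 2nd ed., Thm 1.2. Mathlib: `Metric.hausdorffEDist`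
(`hausdorffEDist_le_of_mem_edist`, `exists_edist_lt_of_hausdorffEDist_lt`,
`hausdorffEDist_closure`), `TopologicalSpace.Closeds.edist_eq`,
`TopologicalSpace.Closeds.isClosed_subsets_of_isClosed`, `ContinuousOn.aemeasurable`,
`MeasureTheory.integral_map`.
-/

noncomputable section

open Set Filter Metric MeasureTheory
open scoped ENNReal unitInterval Topology

namespace Literature.Probability.Percolation

open RandomPlanarGeometry

/-! ### Rerooting two loops at the same parameter -/

section Curve

variable {E : Type*} [PseudoMetricSpace E]

/-- The extension of a curve to `ℝ` (constant outside `[0, 1]`) evaluates the curve at the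
projection onto `[0, 1]` (Aizenman–Burchard 1999, §2.1). [folklore] -/
theorem toPath_extend_apply (γ : Curve E) (x : ℝ) :
    γ.toPath.extend x = γ (projIcc 0 1 zero_le_one x) := rfl

/-- Rerooting two loops at the same parameter `s` and evaluating at the same time `u` gives two
points at distance at most the sup distance of the parametrisations: both rerooted curves visit
the same parameter (`Curve.reroot_apply`) (Camia–Newman 2006, §2.2). [folklore] -/
theorem dist_reroot_apply_le {γ γ' : Curve E} (h : γ.IsLoop) (h' : γ'.IsLoop)
    (s u : unitInterval) :
    dist (γ.reroot s u) (γ'.reroot s u) ≤ dist γ.toContinuousMap γ'.toContinuousMap := by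
  rw [Curve.reroot_apply h, Curve.reroot_apply h']
  split_ifs with hu
  · rw [toPath_extend_apply, toPath_extend_apply]
    exact ContinuousMap.dist_apply_le_dist (f := γ.toContinuousMap) (g := γ'.toContinuousMap) _
  · rw [toPath_extend_apply, toPath_extend_apply]
    exact ContinuousMap.dist_apply_le_dist (f := γ.toContinuousMap) (g := γ'.toContinuousMap) _

/-- Rerooting two loops at the same parameter does not increase the sup distance of the
parametrisations (Camia–Newman 2006, §2.2). [folklore] -/
theorem dist_toContinuousMap_reroot_le {γ γ' : Curve E} (h : γ.IsLoop) (h' : γ'.IsLoop)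
    (s : unitInterval) :
    dist (γ.reroot s).toContinuousMap (γ'.reroot s).toContinuousMap ≤
      dist γ.toContinuousMap γ'.toContinuousMap :=
  (ContinuousMap.dist_le dist_nonneg).2 fun u ↦ dist_reroot_apply_le h h' s u

/-- The reparametrisation distance of two loops rerooted at the same parameter is at most the
sup distance of the original parametrisations (Camia–Newman 2006, §2.2; Aizenman–Burchard
1999, §2.1, eq. (2.2)). [folklore] -/
theorem dist_reroot_reroot_le {γ γ' : Curve E} (h : γ.IsLoop) (h' : γ'.IsLoop)
    (s : unitInterval) :
    dist (γ.reroot s) (γ'.reroot s) ≤ dist γ.toContinuousMap γ'.toContinuousMap :=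
  (Curve.dist_le_dist_toContinuousMap _ _).trans (dist_toContinuousMap_reroot_le h h' s)

/-- If two loops are at reparametrisation distance `< r`, then after replacing the second by a
reparametrisation (same class; a loop again, `Curve.isLoop_reparam` of `UnbasedLoops.lean`)
their rerootings at any common parameter are at distance `< r` (Camia–Newman 2006, §2.2).
[folklore] -/
theorem exists_dist_reroot_reroot_lt {γ γ₀ : Curve E} (h : γ.IsLoop) (h₀ : γ₀.IsLoop) {r : ℝ}
    (hr : dist γ γ₀ < r) (s : unitInterval) :
    ∃ γ' : Curve E, γ'.IsLoop ∧ CurveClass.mk γ' = CurveClass.mk γ₀ ∧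
      dist (γ.reroot s) (γ'.reroot s) < r := by
  obtain ⟨φ, hφ⟩ := Curve.exists_dist_reparam_lt hr
  exact ⟨γ₀.reparam φ, Curve.isLoop_reparam h₀ φ, CurveClass.mk_reparam γ₀ φ,
    (dist_reroot_reroot_le h (Curve.isLoop_reparam h₀ φ) s).trans_lt hφ⟩

end Curve

/-! ### The reroot-saturation is `1`-Lipschitz on loop collections -/

section LoopSpace

variable {E : Type*} [MetricSpace E]

/-- One half of the Hausdorff estimate: if `L, L'` consist of loops and are at Hausdorff
extended distance `< r`, every rerooting of a member of `L` is within `r` of a rerooting of a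
member of `L'` (Camia–Newman 2006, §2.2). [folklore] -/
theorem exists_mem_reroots_edist_le {L L' : LoopSpace E}
    (hL : ∀ c ∈ L, CurveClass.IsLoop c) (hL' : ∀ c ∈ L', CurveClass.IsLoop c) {r : ℝ≥0∞}
    (hr : hausdorffEDist (L : Set (CurveClass E)) L' < r) {x : CurveClass E}
    (hx : x ∈ {c | ∃ (γ : Curve E) (s : unitInterval),
      CurveClass.mk γ ∈ L ∧ c = CurveClass.mk (γ.reroot s)}) :
    ∃ y ∈ {c | ∃ (γ : Curve E) (s : unitInterval),
      CurveClass.mk γ ∈ L' ∧ c = CurveClass.mk (γ.reroot s)}, edist x y ≤ r := by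
  obtain ⟨γ, s, hγ, rfl⟩ := hx
  obtain ⟨c', hc', hlt⟩ := exists_edist_lt_of_hausdorffEDist_lt hγ hr
  obtain ⟨γ₀, rfl⟩ := CurveClass.surjective_mk c'
  have hγl : γ.IsLoop := CurveClass.isLoop_mk.1 (hL _ hγ)
  have hγ₀l : γ₀.IsLoop := CurveClass.isLoop_mk.1 (hL' _ hc')
  rcases eq_or_ne r ∞ with rfl | hr'
  · exact ⟨_, ⟨γ₀, s, hc', rfl⟩, le_top⟩
  rw [← ENNReal.ofReal_toReal hr', edist_lt_ofReal, CurveClass.dist_mk_mk] at hlt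
  obtain ⟨γ', hγ'l, hγ'eq, hlt'⟩ := exists_dist_reroot_reroot_lt hγl hγ₀l hlt s
  refine ⟨CurveClass.mk (γ'.reroot s), ⟨γ', s, hγ'eq ▸ hc', rfl⟩, ?_⟩
  rw [← ENNReal.ofReal_toReal hr']
  exact (edist_lt_ofReal.2 (by rwa [CurveClass.dist_mk_mk])).le

/-- The sets of all rerootings of two collections of loops are no further apart, in Hausdorff
extended distance, than the collections themselves (Camia–Newman 2006, §2.2). [folklore] -/
theorem hausdorffEDist_reroots_le {L L' : LoopSpace E}
    (hL : ∀ c ∈ L, CurveClass.IsLoop c) (hL' : ∀ c ∈ L', CurveClass.IsLoop c) :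
    hausdorffEDist {c | ∃ (γ : Curve E) (s : unitInterval),
        CurveClass.mk γ ∈ L ∧ c = CurveClass.mk (γ.reroot s)}
      {c | ∃ (γ : Curve E) (s : unitInterval),
        CurveClass.mk γ ∈ L' ∧ c = CurveClass.mk (γ.reroot s)} ≤
      hausdorffEDist (L : Set (CurveClass E)) L' := by
  refine le_of_forall_gt_imp_ge_of_dense fun r hr ↦ ?_
  refine hausdorffEDist_le_of_mem_edist (fun x hx ↦ exists_mem_reroots_edist_le hL hL' hr hx)
    fun x hx ↦ exists_mem_reroots_edist_le hL' hL ?_ hx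
  rwa [hausdorffEDist_comm]

/-- **Rerooting is `1`-Lipschitz on loop collections**: for two collections all of whose
members are loops, `edist (rerootSaturation L) (rerootSaturation L') ≤ edist L L'` in the
Aizenman–Burchard space (closure does not change Hausdorff distances)
(Camia–Newman 2006, §2.2: loops modulo reparametrisation; Aizenman–Burchard 1999, §2.1).
[folklore] -/
theorem edist_rerootSaturation_le {L L' : LoopSpace E}
    (hL : ∀ c ∈ L, CurveClass.IsLoop c) (hL' : ∀ c ∈ L', CurveClass.IsLoop c) :
    edist (LoopSpace.rerootSaturation L) (LoopSpace.rerootSaturation L') ≤ edist L L' := by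
  rw [TopologicalSpace.Closeds.edist_eq, TopologicalSpace.Closeds.edist_eq]
  change hausdorffEDist (closure _) (closure _) ≤ _
  rw [hausdorffEDist_closure]
  exact hausdorffEDist_reroots_le hL hL'

/-- `rerootSaturation` is `1`-Lipschitz on the set of loop collections
(Camia–Newman 2006, §2.2). [folklore] -/
theorem lipschitzOnWith_rerootSaturation :
    LipschitzOnWith 1 (LoopSpace.rerootSaturation (E := E))
      {L | ∀ c ∈ L, CurveClass.IsLoop c} := by
  intro L hL L' hL'
  rw [ENNReal.coe_one, one_mul]
  exact edist_rerootSaturation_le hL hL'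

/-- `rerootSaturation` is continuous on the set of loop collections
(Camia–Newman 2006, §2.2). [folklore] -/
theorem continuousOn_rerootSaturation :
    ContinuousOn (LoopSpace.rerootSaturation (E := E)) {L | ∀ c ∈ L, CurveClass.IsLoop c} :=
  lipschitzOnWith_rerootSaturation.continuousOn

/-- The collections all of whose members are loops form a closed subset of the
Aizenman–Burchard space (loops are closed in curve space, `CurveClass.isClosed_setOf_isLoop`,
and "all members in a closed set" is a closed condition for the Hausdorff topology)
(Aizenman–Burchard 1999, §2.1). [folklore] -/
theorem isClosed_setOf_forall_isLoop :
    IsClosed {L : LoopSpace E | ∀ c ∈ L, CurveClass.IsLoop c} :=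
  TopologicalSpace.Closeds.isClosed_subsets_of_isClosed CurveClass.isClosed_setOf_isLoop

/-- The event "all members are loops" is Borel (Aizenman–Burchard 1999, §2.1). [folklore] -/
theorem measurableSet_setOf_forall_isLoop :
    MeasurableSet {L : LoopSpace E | ∀ c ∈ L, CurveClass.IsLoop c} :=
  isClosed_setOf_forall_isLoop.measurableSet

/-- **`rerootSaturation` is a.e.-measurable for every law carried by loop collections**
(continuous on the closed full-measure set of loop collections; `ContinuousOn.aemeasurable`)
(Camia–Newman 2006, §2.2). [folklore] -/
theorem aemeasurable_rerootSaturation {P : Measure (LoopSpace E)}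
    (h : ∀ᵐ L ∂P, ∀ c ∈ L, CurveClass.IsLoop c) :
    AEMeasurable (LoopSpace.rerootSaturation (E := E)) P := by
  have key := (continuousOn_rerootSaturation (E := E)).aemeasurable (μ := P)
    measurableSet_setOf_forall_isLoop
  rwa [Measure.restrict_eq_self_of_ae_mem
    (s := {L : LoopSpace E | ∀ c ∈ L, CurveClass.IsLoop c}) h] at key

/-- Every member of the reroot-saturation of a collection of loops is a loop (rerooted loops are
loops, `Curve.isLoop_reroot`; loops are closed, `CurveClass.isClosed_setOf_isLoop`)
(Camia–Newman 2006, §2.2). [folklore] -/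
theorem isLoop_of_mem_rerootSaturation {L : LoopSpace E} (hL : ∀ c ∈ L, CurveClass.IsLoop c)
    {c : CurveClass E} (hc : c ∈ LoopSpace.rerootSaturation L) : c.IsLoop := by
  refine closure_minimal ?_ CurveClass.isClosed_setOf_isLoop hc
  rintro _ ⟨γ, s, hγ, rfl⟩
  exact CurveClass.isLoop_mk.2 (Curve.isLoop_reroot (CurveClass.isLoop_mk.1 (hL _ hγ)) s)

/-- Rerooting does not move traces: every member of the reroot-saturation of `L` has its trace
in any closed set containing the traces of all members of `L` (`Curve.range_reroot`,
`CurveClass.isClosed_rangeSubset`) (Camia–Newman 2006, §2.2). [folklore] -/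
theorem range_subset_of_mem_rerootSaturation {L : LoopSpace E} {S : Set E} (hS : IsClosed S)
    (hL : ∀ c ∈ L, CurveClass.range c ⊆ S) {c : CurveClass E}
    (hc : c ∈ LoopSpace.rerootSaturation L) : c.range ⊆ S := by
  rw [← CurveClass.mem_rangeSubset]
  refine closure_minimal ?_ (CurveClass.isClosed_rangeSubset hS) hc
  rintro _ ⟨γ, s, hγ, rfl⟩
  rw [CurveClass.mem_rangeSubset]
  by_cases h : γ.IsLoop
  · have := hL _ hγ
    rw [CurveClass.range_mk] at this ⊢
    rwa [Curve.range_reroot h]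
  · rw [Curve.reroot_of_not_isLoop h]
    exact hL _ hγ

/-- The reroot-saturation of a collection lying in a Jordan domain lies in it
(Camia–Newman 2006, §2.2). [folklore] -/
theorem inDomain_rerootSaturation {D : JordanDomain} {L : LoopSpace ℂ}
    (hL : LoopSpace.InDomain D L) : LoopSpace.InDomain D (LoopSpace.rerootSaturation L) :=
  fun _ hc ↦ range_subset_of_mem_rerootSaturation isClosed_closure hL hc

end LoopSpace

/-! ### Limits in law under a change of variables -/

section Laws

/-- **Change of variables in a limit in law.** If `Y δ → Z` in law under `P'` (`TendstoLaw`) and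
`Z` is a.e.-measurable, then `Y δ → id` in law under the push-forward `P'.map Z`: the limit
integrals agree by `MeasureTheory.integral_map` (Billingsley, 2nd ed., §2, the mapping theorem
in its trivial form). [folklore] -/
theorem _root_.Literature.Probability.RandomPlanarGeometry.TendstoLaw.id_map {Ωδ : ℝ → Type*}
    [∀ δ, MeasurableSpace (Ωδ δ)] {Ω' : Type*} [MeasurableSpace Ω'] {X : Type*}
    [TopologicalSpace X] [MeasurableSpace X] [BorelSpace X] {Y : ∀ δ, Ωδ δ → X}
    {P : ∀ δ, Measure (Ωδ δ)} {Z : Ω' → X} {P' : Measure Ω'} (h : TendstoLaw Y P Z P')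
    (hZ : AEMeasurable Z P') : TendstoLaw Y P id (P'.map Z) := by
  intro f
  have hf : ∫ ω, f (id ω) ∂(P'.map Z) = ∫ ω, f (Z ω) ∂P' :=
    integral_map hZ f.continuous.aestronglyMeasurable
  rw [hf]
  exact h f

end Laws

/-! ### Consequences for crit-perc.S05 -/

section CritPerc

open LatticeModels

/-- A rooted scaling limit yields the unrooted limit law: if the percolation loop collections
`triLoopCollection D δ` converge in law to `rerootSaturation` under a law `P'` carried by loop
collections (as `μ D` in `exists_isCLEFamily_six_tendsto`), then they converge in law, with limit
variable `id`, to the push-forward `P'.map rerootSaturation` (Camia–Newman 2006, Thm 1 /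
MSRI 55 (2008), Thm 2, read in the rooted curve space of §2.2). [folklore] -/
theorem tendstoLaw_id_map_rerootSaturation {D : JordanDomain} {P' : Measure (LoopSpace ℂ)}
    (hl : ∀ᵐ L ∂P', ∀ c ∈ L, CurveClass.IsLoop c)
    (h : TendstoLaw (Ωδ := fun _ ↦ SiteConfig (Site 2)) (fun δ ↦ triLoopCollection D δ)
      (fun _ ↦ triSitePercolation half) LoopSpace.rerootSaturation P') :
    TendstoLaw (Ωδ := fun _ ↦ SiteConfig (Site 2)) (fun δ ↦ triLoopCollection D δ)
      (fun _ ↦ triSitePercolation half) id (P'.map LoopSpace.rerootSaturation) :=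
  h.id_map (aemeasurable_rerootSaturation hl)

/-- **The rooted statement determines the unrooted limit law.** If the percolation loop
collections in `D` converge in law both to `rerootSaturation` under a finite law `P'` carried by
loop collections and to `id` under a finite law `P''`, then `P'' = P'.map rerootSaturation`
(uniqueness of limits in law, `TendstoLaw.map_eq`, Billingsley Thm 1.2; a.e.-measurability of
`rerootSaturation` from `aemeasurable_rerootSaturation`). [folklore] -/
theorem law_eq_map_rerootSaturation (D : JordanDomain) {P' P'' : Measure (LoopSpace ℂ)}
    [IsFiniteMeasure P'] [IsFiniteMeasure P''] (hl : ∀ᵐ L ∂P', ∀ c ∈ L, CurveClass.IsLoop c)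
    (h : TendstoLaw (Ωδ := fun _ ↦ SiteConfig (Site 2)) (fun δ ↦ triLoopCollection D δ)
      (fun _ ↦ triSitePercolation half) LoopSpace.rerootSaturation P')
    (h' : TendstoLaw (Ωδ := fun _ ↦ SiteConfig (Site 2)) (fun δ ↦ triLoopCollection D δ)
      (fun _ ↦ triSitePercolation half) id P'') :
    P'' = P'.map LoopSpace.rerootSaturation := by
  have key := h.map_eq h' (aemeasurable_rerootSaturation hl) aemeasurable_id
  rw [Measure.map_id] at key
  exact key.symm

/-- For a CLE-type family `μ` (any parameter) that is a rooted scaling limit of the percolation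
loop collections and any family `ν` of finite laws that is an unrooted scaling limit, `ν D` is
the push-forward of `μ D` along `rerootSaturation` for every Jordan domain `D`; the loops-a.s.
hypothesis comes from `IsCLEFamily.ae_isLoopCollection` (Camia–Newman 2006, Thm 1; MSRI 55
(2008), Thm 2; Billingsley Thm 1.2). [folklore] -/
theorem cnlFamily_eq_map_rerootSaturation {κ : NNReal}
    {μ ν : JordanDomain → Measure (LoopSpace ℂ)} (hμ : IsCLEFamily κ μ)
    (hν : ∀ D, IsFiniteMeasure (ν D))
    (h : ∀ D : JordanDomain, TendstoLaw (Ωδ := fun _ ↦ SiteConfig (Site 2))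
      (fun δ ↦ triLoopCollection D δ) (fun _ ↦ triSitePercolation half)
      LoopSpace.rerootSaturation (μ D))
    (h' : ∀ D : JordanDomain, TendstoLaw (Ωδ := fun _ ↦ SiteConfig (Site 2))
      (fun δ ↦ triLoopCollection D δ) (fun _ ↦ triSitePercolation half) id (ν D)) :
    ν = fun D ↦ (μ D).map LoopSpace.rerootSaturation := by
  funext D
  haveI := hμ.isProbabilityMeasure D
  haveI := hν D
  refine law_eq_map_rerootSaturation D ?_ (h D) (h' D)
  filter_upwards [hμ.ae_isLoopCollection D] with L hL
  exact hL.1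

-- `linter.deprecated` is switched off for the next declaration only: its hypothesis `h₁` is the
-- mis-stated fact `exists_isCLEFamily_six_tendsto`, deprecated (2026-08-16) in `CLE6.lean`; the
-- bridge is kept (deprecated itself), statement verbatim. REMOVE-WHEN that `def` is deleted.
set_option linter.deprecated false in
/-- **Deprecated** (2026-08-16) together with its hypothesis `h₁`, the mis-stated fact
`exists_isCLEFamily_six_tendsto` of `CLE6.lean` (use `exists_isCNLFamily_tendsto` and, for a
general rooted family `μ`, `cnlFamily_eq_map_rerootSaturation` above). *Content (unchanged):*
**crit-perc.S05, rooted ⇒ unrooted law.** If both `exists_isCLEFamily_six_tendsto` (rooted, as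
first vendored) and `exists_isCNLFamily_tendsto` (unrooted, as printed in Camia–Newman, MSRI 55
(2008), Thms 2–3) hold, their witnesses are related by `ν D = (μ D).map rerootSaturation` for
every Jordan domain `D`: the rooted CLE₆-type family determines the Continuum-Nonsimple-Loop
laws (which are unique, `cnlFamily_unique`) — the record that the corrected statement asks for
less than the deprecated one. [folklore] -/
@[deprecated "the hypothesis `exists_isCLEFamily_six_tendsto` is mis-stated (deprecated in CLE6.lean): \
use Literature.Probability.Percolation.cnlFamily_eq_map_rerootSaturation for a general rooted family"
  (since := "2026-08-16")]
theorem exists_cnlFamily_eq_map_rerootSaturation (h₁ : exists_isCLEFamily_six_tendsto)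
    (h₂ : exists_isCNLFamily_tendsto) :
    ∃ (μ ν : JordanDomain → Measure (LoopSpace ℂ)), IsCLEFamily 6 μ ∧ IsCNLFamily ν ∧
      (∀ D : JordanDomain, TendstoLaw (Ωδ := fun _ ↦ SiteConfig (Site 2))
        (fun δ ↦ triLoopCollection D δ) (fun _ ↦ triSitePercolation half) id (ν D)) ∧
      ν = fun D ↦ (μ D).map LoopSpace.rerootSaturation := by
  obtain ⟨μ, hμ, h⟩ := h₁
  obtain ⟨ν, hν, h'⟩ := h₂
  exact ⟨μ, ν, hμ, hν, h', cnlFamily_eq_map_rerootSaturation hμ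
    (fun D ↦ by haveI := hν.isProbabilityMeasure D; infer_instance) h h'⟩

-- `linter.deprecated` is switched off for the next declaration only: its hypothesis `h₁` is the
-- mis-stated fact `exists_isCLEFamily_six_tendsto`, deprecated (2026-08-16) in `CLE6.lean`; the
-- bridge is kept (deprecated itself), statement verbatim. REMOVE-WHEN that `def` is deleted.
set_option linter.deprecated false in
/-- **Deprecated** (2026-08-16) together with its hypothesis `h₁`, the mis-stated fact
`exists_isCLEFamily_six_tendsto` of `CLE6.lean` (use `exists_isCNLFamily_tendsto`, whose
convergence half this conclusion is, and `tendstoLaw_id_map_rerootSaturation` above for a general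
rooted law). *Content (unchanged):* under the rooted statement alone, the push-forwards
`(μ D).map rerootSaturation` are probability laws that are unrooted scaling limits of the
percolation loop collections in every Jordan domain — the convergence half of
`exists_isCNLFamily_tendsto` (Camia–Newman, MSRI 55 (2008), Thm 2), without the CNL axioms.
[folklore] -/
@[deprecated "the hypothesis `exists_isCLEFamily_six_tendsto` is mis-stated (deprecated in CLE6.lean): \
use Literature.Probability.Percolation.exists_isCNLFamily_tendsto, or \
Literature.Probability.Percolation.tendstoLaw_id_map_rerootSaturation for a general rooted law"
  (since := "2026-08-16")]
theorem exists_tendstoLaw_id_of_exists_isCLEFamily_six_tendsto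
    (h₁ : exists_isCLEFamily_six_tendsto) :
    ∃ ν : JordanDomain → Measure (LoopSpace ℂ), (∀ D, IsProbabilityMeasure (ν D)) ∧
      ∀ D : JordanDomain, TendstoLaw (Ωδ := fun _ ↦ SiteConfig (Site 2))
        (fun δ ↦ triLoopCollection D δ) (fun _ ↦ triSitePercolation half) id (ν D) := by
  obtain ⟨μ, hμ, h⟩ := h₁
  have hl : ∀ D, ∀ᵐ L ∂(μ D), ∀ c ∈ L, CurveClass.IsLoop c := fun D ↦ by
    filter_upwards [hμ.ae_isLoopCollection D] with L hL
    exact hL.1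
  refine ⟨fun D ↦ (μ D).map LoopSpace.rerootSaturation, fun D ↦ ?_, fun D ↦ ?_⟩
  · haveI := hμ.isProbabilityMeasure D
    exact Measure.isProbabilityMeasure_map (aemeasurable_rerootSaturation (hl D))
  · exact tendstoLaw_id_map_rerootSaturation (hl D) (h D)

end CritPerc

end Literature.Probability.Percolation
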